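import Mathlib
import Literature.AlgebraicGeometry.Resolution.FormalInverseFunction
import Summits.ResolutionOfSingularities.ResolutionOfSingularities.Theorems.WeightedInvariantLocalWeightedDropTOT2NoLinePlaneKill
import Summits.ResolutionOfSingularities.ResolutionOfSingularities.Theorems.WeightedInvariantLocalWeightedDropTOT2CurveConflictShift

/-!
# TOT2-LINE (P3) brick D8, part 2/3: the FORMAL IMPLICIT FUNCTION and `P = σ_φ⁻¹(u₂, y)` for a line-type top-locus prime

Sub-problem `ResolutionOfSingularities`, ENGINE crux `stmt-ResolutionOfSingularities-8899` (`LocalWeightedDrop`), skeleton v35 (2e806da509994632),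
registered stub `stub_conflictBudget` (P3); dictionary brick **D8 `X_one_not_mem_of_wellPrepared`** — the hypothesis `hNL` of the graph step of the
conflict budget (res-L1-w43-stub-2 g6 WANT-HAND 2026-08-27T21:24:55Z, exact target; res-L1-w43-plan-1 RULING 21:25:12Z; this hand res-L1-w43-stub-1 g7).
[OURS · L1 W4.3 · chain w43.  Engine bookkeeping: nothing here is a statement of any manuscript; AI-produced, gate-checked, weaker than expert review.
«[OURS · L1 W4.3] replaces the role of nothing printed; NOT a statement of the manuscript.»]

* `exists_branch_of_coeff_ne_zero` — a plane series `g(u,Y)` with `g(0,0) = 0`, `∂g/∂Y(0,0) ≠ 0` vanishes on a graph `Y = φ(u)`, `φ(0) = 0`, `φ`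
  `Y`-free (from the tree's formal inverse function theorem `FormalCoordChange.exists_comp_inverse` applied to `(u, Y) ↦ (u, g)`);
* `eq_comap_recentre_ker` — with `ι⁻¹P = (g)` (part 1) and such a `φ`: `P = σ⁻¹(ker κ₁)` where `σ = subst (NCPoly.recentre φ)` is the re-centring
  `y ↦ y + φ(u₁)` and `κ₁ : (u₁,u₂,y) ↦ (u₁,0,0)` (two `k`-algebra maps `R₃ → R₃` agreeing on the variables are equal — `Jets.algHom_ext_X` — so
  `f ∈ P ⇒ f(u₁, 0, φ(u₁)) = 0`; then equality by dimension one).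
-/

set_option linter.dupNamespace false -- mandated namespace of this single-conjunct summit

noncomputable section

namespace Summit.ResolutionOfSingularities.ResolutionOfSingularities.Theorems

namespace TOT2Branch

open MvPowerSeries IsLocalRing
open Literature.AlgebraicGeometry.Resolution (FormalCoordChange.linMat)

variable {k : Type} [Field k]

/-! ## §3 The implicit function: a plane series with `∂g/∂y (0) ≠ 0` vanishes on a graph `y = φ(u₁)` -/

/-- **FORMAL IMPLICIT FUNCTION** (from the tree's formal inverse function theorem `FormalCoordChange.exists_comp_inverse` for the coordinate change
`(u, Y) ↦ (u, g(u,Y))`): if `g(0,0) = 0` and the `Y`-linear coefficient of `g` is non-zero, there is a `Y`-free `φ(u)` with `φ(0) = 0` and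
`g(u, φ(u)) = 0`. -/
theorem exists_branch_of_coeff_ne_zero {g : MvPowerSeries (Fin 2) k} (hg0 : constantCoeff g = 0)
    (hg1 : coeff (Finsupp.single 1 1) g ≠ 0) :
    ∃ φ : MvPowerSeries (Fin 2) k, constantCoeff φ = 0 ∧ (∀ e : Fin 2 →₀ ℕ, e 1 ≠ 0 → coeff e φ = 0) ∧
      subst (![X 0, φ] : Fin 2 → MvPowerSeries (Fin 2) k) g = 0 := by
  set θ : Fin 2 → MvPowerSeries (Fin 2) k := ![X 0, g] with hθ
  have h0 : ∀ i, constantCoeff (θ i) = 0 := by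
    intro i; fin_cases i; exacts [constantCoeff_X 0, hg0]
  have hdet : IsUnit (FormalCoordChange.linMat θ).det := by
    rw [Matrix.det_fin_two]
    simp only [FormalCoordChange.linMat, Matrix.of_apply, hθ, Matrix.cons_val_zero, Matrix.cons_val_one,
      coeff_X, Finsupp.single_eq_single_iff]
    simp only [one_ne_zero, false_and, or_false, and_true, if_true, if_false, one_mul, zero_mul, sub_zero]
    exact isUnit_iff_ne_zero.mpr hg1
  obtain ⟨ψ, hψ0, hψθ, -⟩ := Literature.AlgebraicGeometry.Resolution.FormalCoordChange.exists_comp_inverse h0 hdet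
  have hψs : HasSubst ψ := hasSubst_of_constantCoeff_zero hψ0
  have hψ0' : ψ 0 = X 0 := by
    have h := hψθ 0
    rwa [show θ 0 = X 0 from rfl, subst_X hψs] at h
  have hg : subst ψ g = X 1 := hψθ 1
  have hk : HasSubst (![X 0, 0] : Fin 2 → MvPowerSeries (Fin 2) k) := TOT2Curve.hasSubst_killTwo
  refine ⟨subst (![X 0, 0] : Fin 2 → MvPowerSeries (Fin 2) k) (ψ 1), ?_, fun e he => ?_, ?_⟩
  · rw [← coeff_zero_eq_constantCoeff_apply, TOT2Curve.coeff_subst_killTwo, if_pos (by simp), coeff_zero_eq_constantCoeff_apply, hψ0]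
  · rw [TOT2Curve.coeff_subst_killTwo, if_neg he]
  · have hcomp : (fun i => subst (![X 0, 0] : Fin 2 → MvPowerSeries (Fin 2) k) (ψ i)) =
        ![X 0, subst (![X 0, 0] : Fin 2 → MvPowerSeries (Fin 2) k) (ψ 1)] := by
      funext i
      fin_cases i
      · simp only [Fin.zero_eta, Matrix.cons_val_zero, hψ0', subst_X hk]
      · rfl
    rw [← hcomp, ← subst_comp_subst_apply hψs hk, hg, subst_X hk]
    rfl

/-! ## §4 The line-type prime is the pull-back of `(u₂, y)` along the re-centring `y ↦ y + φ(u₁)` -/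

/-- The embedding of the `u₁`-axis `Fin 1 ↪ Fin 3` (`0 ↦ 0`) as a composite through the plane. -/
theorem axisEmb_apply : ((Fin.succAboveEmb (1 : Fin 2)).trans (Fin.succAboveEmb (1 : Fin 3))) 0 = (0 : Fin 3) := by decide

/-- A `u₂`-free plane series is the renaming of a one-variable series. -/
theorem eq_rename_killCompl_of_noY {φ : MvPowerSeries (Fin 2) k} (hφ : ∀ e : Fin 2 →₀ ℕ, e 1 ≠ 0 → coeff e φ = 0) :
    φ = rename (Fin.succAboveEmb (1 : Fin 2)) (killCompl (Fin.succAboveEmb (1 : Fin 2)) φ) := by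
  refine (rename_killCompl_of_coeff_eq_zero _ φ fun x hx => hφ x fun h1 => hx ?_).symm
  intro i hi
  rw [Finset.mem_coe, Finsupp.mem_support_iff] at hi
  fin_cases i
  · exact ⟨0, by decide⟩
  · exact absurd h1 hi

/-- For a `u₂`-free plane series, `toThree φ` is its renaming along the `u₁`-axis embedding, and equals `ι φ`. -/
theorem toThree_eq_rename_axis {φ : MvPowerSeries (Fin 2) k} (hφ : ∀ e : Fin 2 →₀ ℕ, e 1 ≠ 0 → coeff e φ = 0) :
    toThree φ = rename ((Fin.succAboveEmb (1 : Fin 2)).trans (Fin.succAboveEmb (1 : Fin 3)))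
      (killCompl (Fin.succAboveEmb (1 : Fin 2)) φ) ∧
    rename (Fin.succAboveEmb (1 : Fin 3)) φ = rename ((Fin.succAboveEmb (1 : Fin 2)).trans (Fin.succAboveEmb (1 : Fin 3)))
      (killCompl (Fin.succAboveEmb (1 : Fin 2)) φ) := by
  have hφ' := eq_rename_killCompl_of_noY hφ
  have hf1 : ((Fin.succAboveEmb (Fin.last 2) : Fin 2 → Fin 3) ∘ (Fin.succAboveEmb (1 : Fin 2) : Fin 1 → Fin 2)) =
      ((Fin.succAboveEmb (1 : Fin 2)).trans (Fin.succAboveEmb (1 : Fin 3)) : Fin 1 → Fin 3) := by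
    funext i; fin_cases i; rfl
  have hf2 : ((Fin.succAboveEmb (1 : Fin 3) : Fin 2 → Fin 3) ∘ (Fin.succAboveEmb (1 : Fin 2) : Fin 1 → Fin 2)) =
      ((Fin.succAboveEmb (1 : Fin 2)).trans (Fin.succAboveEmb (1 : Fin 3)) : Fin 1 → Fin 3) := by
    funext i; fin_cases i; rfl
  constructor
  · conv_lhs => rw [hφ']
    change rename (Fin.succAboveEmb (Fin.last 2)) (rename _ _) = _
    simp only [rename_rename, hf1]
  · conv_lhs => rw [hφ']
    simp only [rename_rename, hf2]

/-- **THE LINE-TYPE PRIME IS THE RE-CENTRED AXIS PRIME.**  With the data of `exists_generator_comap` and a branch `φ` of the generator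
(`g(u₁, φ(u₁)) = 0`): `P` equals the pull-back along the re-centring `σ : y ↦ y + φ(u₁)` of the kernel `Q₀` of `(u₁,u₂,y) ↦ (u₁,0,0)`
(i.e. `P = σ⁻¹(u₂, y) = (u₂, y − φ(u₁))`). -/
theorem eq_comap_recentre_ker {P : Ideal (MvPowerSeries (Fin 3) k)} [hP : P.IsPrime]
    (hdim : ringKrullDim (MvPowerSeries (Fin 3) k ⧸ P) = 1) (hX1 : (X 1 : MvPowerSeries (Fin 3) k) ∈ P)
    {g : MvPowerSeries (Fin 2) k}
    (hQg : P.comap (rename (Fin.succAboveEmb (1 : Fin 3)) : MvPowerSeries (Fin 2) k →ₐ[k] MvPowerSeries (Fin 3) k) = Ideal.span {g})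
    {φ : MvPowerSeries (Fin 2) k} (hφ0 : constantCoeff φ = 0) (hφ : ∀ e : Fin 2 →₀ ℕ, e 1 ≠ 0 → coeff e φ = 0)
    (hgφ : subst (![X 0, φ] : Fin 2 → MvPowerSeries (Fin 2) k) g = 0) :
    P = (RingHom.ker (killCompl ((Fin.succAboveEmb (1 : Fin 2)).trans (Fin.succAboveEmb (1 : Fin 3))) :
        MvPowerSeries (Fin 3) k →ₐ[k] MvPowerSeries (Fin 1) k).toRingHom).comap
      ((substAlgHom (hasSubst_of_constantCoeff_zero (NCPoly.constantCoeff_recentre hφ0)) :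
        MvPowerSeries (Fin 3) k →ₐ[k] MvPowerSeries (Fin 3) k) : MvPowerSeries (Fin 3) k →+* MvPowerSeries (Fin 3) k) := by
  classical
  -- the maps
  set e : Fin 2 ↪ Fin 3 := Fin.succAboveEmb (1 : Fin 3) with he
  set e₁ : Fin 1 ↪ Fin 2 := Fin.succAboveEmb (1 : Fin 2) with he₁
  set e₀ : Fin 1 ↪ Fin 3 := e₁.trans e with he₀
  set ι : MvPowerSeries (Fin 2) k →ₐ[k] MvPowerSeries (Fin 3) k := rename e with hι
  set ρ : MvPowerSeries (Fin 3) k →ₐ[k] MvPowerSeries (Fin 2) k := killCompl e with hρ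
  set κ₁ : MvPowerSeries (Fin 3) k →ₐ[k] MvPowerSeries (Fin 1) k := killCompl e₀ with hκ₁
  set σ : MvPowerSeries (Fin 3) k →ₐ[k] MvPowerSeries (Fin 3) k :=
    substAlgHom (hasSubst_of_constantCoeff_zero (NCPoly.constantCoeff_recentre hφ0)) with hσ
  have hσs : HasSubst (NCPoly.recentre φ) := hasSubst_of_constantCoeff_zero (NCPoly.constantCoeff_recentre hφ0)
  have hev : HasSubst (![X 0, φ] : Fin 2 → MvPowerSeries (Fin 2) k) :=
    hasSubst_of_constantCoeff_zero (fun i => by fin_cases i; exacts [constantCoeff_X 0, hφ0])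
  set ev : MvPowerSeries (Fin 2) k →ₐ[k] MvPowerSeries (Fin 2) k := substAlgHom hev with hevdef
  set φ₁ : MvPowerSeries (Fin 1) k := killCompl e₁ φ with hφ₁
  obtain ⟨hφ3, hιφ⟩ := toThree_eq_rename_axis hφ
  -- the two evaluations agree
  have hE : (ι.comp (ev.comp ρ)) = ((rename e₀).comp (κ₁.comp σ) : MvPowerSeries (Fin 3) k →ₐ[k] MvPowerSeries (Fin 3) k) := by
    apply Literature.RingTheory.MvPowerSeries.Jets.algHom_ext_X
    intro s
    simp only [AlgHom.comp_apply]
    fin_cases s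
    · -- `u₁`
      have h1 : ρ (X 0) = X 0 := by rw [hρ, he, ← succAbove_one_zero, killCompl_X]
      have h2 : ev (X 0 : MvPowerSeries (Fin 2) k) = X 0 := by rw [hevdef, substAlgHom_apply, subst_X hev]; rfl
      have h3 : σ (X 0) = X 0 := by
        rw [hσ, substAlgHom_apply, subst_X hσs, NCPoly.recentre_of_ne φ (by decide)]
      have h4 : κ₁ (X 0 : MvPowerSeries (Fin 3) k) = X 0 := by rw [hκ₁, he₀, ← axisEmb_apply, killCompl_X]
      change ι (ev (ρ (X 0))) = rename e₀ (κ₁ (σ (X 0)))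
      rw [h1, h2, h3, h4, hι, rename_X, rename_X]
      rfl
    · -- `u₂`
      have h1 : ρ (X 1) = 0 := by rw [hρ, he]; exact killCompl_X_eq_zero one_not_mem_range_succAbove_one
      have h3 : σ (X 1) = X 1 := by
        rw [hσ, substAlgHom_apply, subst_X hσs, NCPoly.recentre_of_ne φ (by decide)]
      have h4 : κ₁ (X 1 : MvPowerSeries (Fin 3) k) = 0 := by
        rw [hκ₁]; refine killCompl_X_eq_zero ?_; rintro ⟨i, hi⟩; fin_cases i; exact absurd hi (by decide)
      change ι (ev (ρ (X 1))) = rename e₀ (κ₁ (σ (X 1)))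
      rw [h1, map_zero, map_zero, h3, h4, map_zero]
    · -- `y`
      have h1 : ρ (X 2) = X 1 := by rw [hρ, he, ← succAbove_one_one, killCompl_X]
      have h2 : ev (X 1 : MvPowerSeries (Fin 2) k) = φ := by rw [hevdef, substAlgHom_apply, subst_X hev]; rfl
      have h3 : σ (X 2) = X 2 + toThree φ := by
        rw [hσ, substAlgHom_apply, subst_X hσs, show (2 : Fin 3) = Fin.last 2 from rfl, NCPoly.recentre_last]
        rfl
      have h4 : κ₁ (X 2 : MvPowerSeries (Fin 3) k) = 0 := by
        rw [hκ₁]; refine killCompl_X_eq_zero ?_; rintro ⟨i, hi⟩; fin_cases i; exact absurd hi (by decide)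
      have h5 : κ₁ (toThree φ) = φ₁ := by rw [hφ3, hκ₁, he₀, he₁, he, killCompl_rename_app]
      change ι (ev (ρ (X 2))) = rename e₀ (κ₁ (σ (X 2)))
      rw [h1, h2, h3, map_add, h4, zero_add, h5, hι, he, hιφ]
  -- `P ≤ P″`
  have hle : P ≤ (RingHom.ker κ₁.toRingHom).comap (σ : MvPowerSeries (Fin 3) k →+* MvPowerSeries (Fin 3) k) := by
    intro f hf
    rw [Ideal.mem_comap, RingHom.mem_ker]
    change κ₁ (σ f) = 0
    have h1 : ρ f ∈ Ideal.span {g} := by rw [← hQg]; exact (mem_iff_killCompl_mem_comap hX1 f).mp hf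
    obtain ⟨t, ht⟩ := Ideal.mem_span_singleton.mp h1
    have h2 : ι (ev (ρ f)) = 0 := by
      rw [ht, map_mul, hevdef, substAlgHom_apply, hgφ, zero_mul, map_zero]
    have h3 : rename e₀ (κ₁ (σ f)) = 0 := by
      have := congrArg (fun F : MvPowerSeries (Fin 3) k →ₐ[k] MvPowerSeries (Fin 3) k => F f) hE
      simp only [AlgHom.comp_apply] at this
      rw [← this]; exact h2
    exact rename_injective e₀ (by rw [h3, map_zero])
  -- equality by dimension
  haveI : IsDomain (MvPowerSeries (Fin 1) k) := NoZeroDivisors.to_isDomain _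
  haveI hprime : ((RingHom.ker κ₁.toRingHom).comap (σ : MvPowerSeries (Fin 3) k →+* MvPowerSeries (Fin 3) k)).IsPrime := by
    haveI : (RingHom.ker κ₁.toRingHom).IsPrime := RingHom.ker_isPrime _
    exact Ideal.comap_isPrime _ _
  by_contra hne
  have hlt : P < (RingHom.ker κ₁.toRingHom).comap (σ : MvPowerSeries (Fin 3) k →+* MvPowerSeries (Fin 3) k) := lt_of_le_of_ne hle hne
  have hmax := eq_maximalIdeal_of_lt_of_ringKrullDim hdim hlt
  have hX0' : (X 0 : MvPowerSeries (Fin 3) k) ∈ (RingHom.ker κ₁.toRingHom).comap (σ : MvPowerSeries (Fin 3) k →+* MvPowerSeries (Fin 3) k) := by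
    rw [hmax]; exact Literature.AlgebraicGeometry.Resolution.X_mem_maximalIdeal k (Fin 3) 0
  rw [Ideal.mem_comap, RingHom.mem_ker] at hX0'
  have h3 : σ (X 0) = X 0 := by rw [hσ, substAlgHom_apply, subst_X hσs, NCPoly.recentre_of_ne φ (by decide)]
  have h4 : κ₁ (X 0 : MvPowerSeries (Fin 3) k) = X 0 := by rw [hκ₁, he₀, ← axisEmb_apply, killCompl_X]
  have : (X 0 : MvPowerSeries (Fin 1) k) = 0 := by
    have h := hX0'
    change κ₁ (σ (X 0)) = 0 at h
    rwa [h3, h4] at h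
  exact X_zero_ne_zero_one this

end TOT2Branch

end Summit.ResolutionOfSingularities.ResolutionOfSingularities.Theorems

end
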